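import Literature.NumberTheory.Transcendental.QuadraticRelationsLogarithmsThm32B
import HarnessLib

/-!
# Roy–Waldschmidt 1997, Théorème 3.2 — part C: step 4, (3.10) infinitely often, and the theorem

Conclusion of the proof of **Théorème 3.2** (p. 763; proof (iv) pp. 769–771) of D. Roy,
M. Waldschmidt, Ann. Sci. ÉNS (4) 30 (1997), begun in `…Thm32A.lean` / `…Thm32B.lean`:

* `step_four` — **step 4** (p. 771): the negation (3.11) of (3.10) beyond `n₀` is contradictory
  (two applications of step 3 and of the pair lemma, then the comparison of
  `log M(Q_{m+1})/deg Q_{m+1} = log M(Q_n)/deg Q_n`);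
* `infinitely_often` — (3.10) holds for infinitely many `n`;
* `thm_3_2` — **Théorème 3.2** with `c₀ = 10⁷`: for `θ ∈ ℂ` transcendental and `κ ≥ 10⁷` there are
  irreducible `P ∈ ℤ[X]` of arbitrarily large degree `d` with `log M(P) ≤ κ d` (i.e. a root `α` of
  degree `d` and absolute logarithmic height `h(α) = log M(P)/d ≤ κ`) and a root `α` with
  `|θ - α| ≤ exp(-10⁻⁷ κ d²)`.  The passage from "infinitely many `n`" to "infinitely many degrees"
  is Northcott's finiteness theorem (Mathlib `Polynomial.finite_mahlerMeasure_le`), as on p. 770.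

No definitions, no named facts.

## References

* [RoyWaldschmidt1997ENS] D. Roy, M. Waldschmidt, Ann. Sci. ÉNS (4) 30 (1997) 753–796,
  Théorème 3.2 p. 763 and §3 (iv) pp. 769–771 (lit key paper:doi-10-1016-s0012-9593-97-89938-7).
-/

noncomputable section

open Polynomial Multiset

namespace Literature.NumberTheory.Transcendental

namespace RoyWaldschmidt1997

/-! ### Step 4 -/

/-- The final numerical contradiction of step 4 over the reals: with `A = log M(Q_{m+1})`,
`B = deg Q_{m+1}`, `C = log M(Q_n)`, `D = deg Q_n`, `A D = C B` (same irreducible base),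
`3 d A ≥ κm²/64800` for some `d ≤ m`, `B < (m+1)/3600`, `C ≤ κn/3600`, `D ≥ (n+1)/60`,
`m ≥ 20`: impossible. [folklore] -/
theorem step4_num {κ m n A B C D d : ℝ} (hκ : 0 < κ) (hm : 20 ≤ m) (hn0 : 0 ≤ n)
    (hA0 : 0 ≤ A) (hB0 : 0 ≤ B) (hdm : d ≤ m)
    (hAd : κ * m ^ 2 / 64800 ≤ 3 * d * A) (hB : B < (m + 1) / 3600) (hC : C ≤ κ * n / 3600)
    (hD : (n + 1) / 60 ≤ D) (hADCB : A * D = C * B) : False := by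
  -- `A ≥ κ m / 194400`
  have hA : κ * m / 194400 ≤ A := by
    have h1 : 3 * d * A ≤ 3 * m * A := by nlinarith
    have h2 : κ * m ^ 2 / 64800 ≤ 3 * m * A := hAd.trans h1
    have hm0 : 0 < m := by linarith
    have h3 : m * (κ * m / 64800) ≤ m * (3 * A) := by nlinarith
    have h4 := le_of_mul_le_mul_left h3 hm0
    linarith
  -- lower bound for `A D`, upper bound for `C B`
  have hlow : κ * m / 194400 * ((n + 1) / 60) ≤ A * D :=
    mul_le_mul hA hD (by positivity) hA0
  have hup : C * B ≤ κ * n / 3600 * ((m + 1) / 3600) := by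
    have h1 : C * B ≤ κ * n / 3600 * B := mul_le_mul_of_nonneg_right hC hB0
    have h2 : κ * n / 3600 * B ≤ κ * n / 3600 * ((m + 1) / 3600) :=
      mul_le_mul_of_nonneg_left hB.le (by positivity)
    linarith
  rw [hADCB] at hlow
  have h : κ * m / 194400 * ((n + 1) / 60) ≤ κ * n / 3600 * ((m + 1) / 3600) := hlow.trans hup
  -- i.e. `10 m (n+1) ≤ 9 n (m+1)`, impossible for `m ≥ 20`
  have h' : κ * (10 * m * (n + 1)) ≤ κ * (9 * n * (m + 1)) := by nlinarith
  have h'' := le_of_mul_le_mul_left h' hκ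
  nlinarith

set_option maxHeartbeats 400000 in
/-- **Step 4** (p. 771): under the hypotheses on the sequence (`κ ≥ 3600`), the negation (3.11) of
(3.10) beyond some `n₀ ≥ max(δ₁, 20)` is contradictory.
[cite: RoyWaldschmidt1997ENS, §3 (iv) step 4, p. 771] -/
theorem step_four (θ : ℂ) (hθ : Transcendental ℚ θ) (κ : ℝ) (hκ : 3600 ≤ κ) (δ₁ : ℕ)
    (R : ℕ → ℤ[X]) (k : ℕ → ℕ) (α : ℕ → ℂ)
    (hQ : ∀ t, δ₁ ≤ t → Irreducible (R t) ∧ 0 < k t ∧ (R t ^ k t).natDegree ≤ t ∧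
      Real.log ((R t ^ k t).map (Int.castRingHom ℂ)).mahlerMeasure ≤ κ * t / 3600 ∧
      ‖aeval θ (R t ^ k t)‖ ≤ Real.exp (-(κ * t ^ 2 / 64800)))
    (hα : ∀ t, δ₁ ≤ t → α t ∈ ((R t).map (Int.castRingHom ℂ)).roots ∧
      ∀ β ∈ ((R t).map (Int.castRingHom ℂ)).roots, ‖θ - α t‖ ≤ ‖θ - β‖)
    (n₀ : ℕ) (hn₀δ : δ₁ ≤ n₀) (hn₀20 : 20 ≤ n₀)
    (h11 : ∀ t, n₀ ≤ t →
      ¬ ((t : ℝ) / 3600 ≤ (R t ^ k t).natDegree ∧ ‖θ - α t‖ ≤ Real.exp (-(κ * t ^ 2 / 10 ^ 7)))) :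
    False := by
  have hκpos : 0 < κ := by linarith
  -- `m`: largest index of the class of `n₀`; `n`: largest index of the class of `m + 1`
  obtain ⟨m, hn₀m, hassm, hmaxm⟩ := exists_max_associated θ hθ κ hκpos δ₁ R k hQ n₀ hn₀δ (by omega)
  have hδm : δ₁ ≤ m := hn₀δ.trans hn₀m
  have hδm1 : δ₁ ≤ m + 1 := hδm.trans (Nat.le_succ m)
  have hm20 : 20 ≤ m := hn₀20.trans hn₀m
  have hDm := step_three θ hθ κ hκ δ₁ R k α hQ hα n₀ hn₀δ hn₀20 h11 n₀ le_rfl m hn₀m hassm hmaxm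
  obtain ⟨n, hmn, hassn, hmaxn⟩ := exists_max_associated θ hθ κ hκpos δ₁ R k hQ (m + 1) hδm1 (Nat.succ_pos m)
  have hδn : δ₁ ≤ n := hδm1.trans hmn
  have hδn1 : δ₁ ≤ n + 1 := hδn.trans (Nat.le_succ n)
  have hn20 : 20 ≤ n := by omega
  have hDn := step_three θ hθ κ hκ δ₁ R k α hQ hα n₀ hn₀δ hn₀20 h11 (m + 1) (by omega) n hmn hassn hmaxn
  have hfm := seq_facts θ hθ κ hκpos δ₁ R k hQ m hδm (by omega)
  have hfm1 := seq_facts θ hθ κ hκpos δ₁ R k hQ (m + 1) hδm1 (Nat.succ_pos m)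
  have hfn := seq_facts θ hθ κ hκpos δ₁ R k hQ n hδn (by omega)
  have hfn1 := seq_facts θ hθ κ hκpos δ₁ R k hQ (n + 1) hδn1 (Nat.succ_pos n)
  obtain ⟨hRm, hkm, hdegQm, hMm, hsmm⟩ := hQ m hδm
  obtain ⟨hRm1, hkm1, hdegQm1, hMm1, hsmm1⟩ := hQ (m + 1) hδm1
  obtain ⟨hRn, hkn, hdegQn, hMn, hsmn⟩ := hQ n hδn
  obtain ⟨hRn1, hkn1, hdegQn1, hMn1, hsmn1⟩ := hQ (n + 1) hδn1
  -- non-association of consecutive terms at `m` and at `n`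
  have hna : ¬ Associated (R (m + 1)) (R m) := fun h =>
    absurd (hmaxm (m + 1) hδm1 (Nat.succ_pos m) (hassm.trans h.symm)) (by omega)
  have hnan : ¬ Associated (R (n + 1)) (R n) := fun h =>
    absurd (hmaxn (n + 1) hδn1 (Nat.succ_pos n) (hassn.trans h.symm)) (by omega)
  -- pair lemma at `(m+1, m)` and at `(n+1, n)`
  obtain ⟨hdA, -, hlogA, -, -⟩ := pair_step θ κ hκ δ₁ R k α hQ hα (m + 1) m m hδm1 hδm
    (le_trans (by norm_num) hm20) (Nat.le_succ m) le_rfl le_rfl (Nat.le_succ m) hDm.le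
    (isCoprime_pow_of_not_associated hRm1 hRm hfm1.2.1 hfm.2.1 hna _ _)
    (h11 (m + 1) (by omega)) (h11 m hn₀m)
  obtain ⟨-, hdD, -, -, -⟩ := pair_step θ κ hκ δ₁ R k α hQ hα (n + 1) n n hδn1 hδn
    (le_trans (by norm_num) hn20) (Nat.le_succ n) le_rfl le_rfl (Nat.le_succ n) hDn.le
    (isCoprime_pow_of_not_associated hRn1 hRn hfn1.2.1 hfn.2.1 hnan _ _)
    (h11 (n + 1) (by omega)) (h11 n (by omega))
  -- same base for `Q_{m+1}` and `Q_n`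
  set e : ℕ := (R (m + 1)).natDegree with he
  set ℓ : ℝ := Real.log ((R (m + 1)).map (Int.castRingHom ℂ)).mahlerMeasure with hℓ
  have hen : (R n).natDegree = e := natDegree_eq_of_associated hassn
  have hℓn : Real.log ((R n).map (Int.castRingHom ℂ)).mahlerMeasure = ℓ := by
    rw [mahlerMeasure_eq_of_associated hassn]
  have hAeq : Real.log ((R (m + 1) ^ k (m + 1)).map (Int.castRingHom ℂ)).mahlerMeasure = k (m + 1) * ℓ :=
    log_mahlerMeasure_pow _ _
  have hBeq : ((R (m + 1) ^ k (m + 1)).natDegree : ℝ) = k (m + 1) * e := by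
    rw [natDegree_pow]; push_cast; ring
  have hCeq : Real.log ((R n ^ k n).map (Int.castRingHom ℂ)).mahlerMeasure = k n * ℓ := by
    rw [log_mahlerMeasure_pow, hℓn]
  have hDeq : ((R n ^ k n).natDegree : ℝ) = k n * e := by
    rw [natDegree_pow, hen]; push_cast; ring
  -- `3 deg(Q_m) log M(Q_{m+1}) ≥ κ m² / 64800`
  have hlogQm : Real.log ‖aeval θ (R m ^ k m)‖ ≤ -(κ * m ^ 2 / 64800) := by
    have := Real.log_le_log (by rw [map_pow, norm_pow]; exact pow_pos hfm.2.2.1 _) hsmm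
    rwa [Real.log_exp] at this
  have hAd : κ * (m : ℝ) ^ 2 / 64800 ≤ 3 * ((R m ^ k m).natDegree : ℝ) *
      Real.log ((R (m + 1) ^ k (m + 1)).map (Int.castRingHom ℂ)).mahlerMeasure := by linarith
  have hdm : ((R m ^ k m).natDegree : ℝ) ≤ m := by exact_mod_cast hdegQm
  have hℓ0 : 0 ≤ ℓ := Real.log_nonneg (one_le_mahlerMeasure_of_ne_zero hRm1.ne_zero)
  refine step4_num hκpos (by exact_mod_cast hm20) (Nat.cast_nonneg n)
    (A := Real.log ((R (m + 1) ^ k (m + 1)).map (Int.castRingHom ℂ)).mahlerMeasure)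
    (B := ((R (m + 1) ^ k (m + 1)).natDegree : ℝ))
    (C := Real.log ((R n ^ k n).map (Int.castRingHom ℂ)).mahlerMeasure)
    (D := ((R n ^ k n).natDegree : ℝ))
    (Real.log_nonneg (one_le_mahlerMeasure_of_ne_zero (pow_ne_zero _ hRm1.ne_zero)))
    (Nat.cast_nonneg _) hdm hAd (by push_cast at hdA ⊢; exact hdA) hMn hdD ?_
  rw [hAeq, hBeq, hCeq, hDeq]; ring

/-! ### (3.10) infinitely often -/

/-- **(3.10) holds for infinitely many `n`** (p. 770): under the hypotheses on the sequence
(`κ ≥ 3600`), for every `N` there is `t ≥ N` with `deg Q_t ≥ t/3600` and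
`|θ - α_t| ≤ exp(-10⁻⁷ κ t²)`. [cite: RoyWaldschmidt1997ENS, §3 (iv), (3.10), p. 770] -/
theorem infinitely_often (θ : ℂ) (hθ : Transcendental ℚ θ) (κ : ℝ) (hκ : 3600 ≤ κ) (δ₁ : ℕ)
    (R : ℕ → ℤ[X]) (k : ℕ → ℕ) (α : ℕ → ℂ)
    (hQ : ∀ t, δ₁ ≤ t → Irreducible (R t) ∧ 0 < k t ∧ (R t ^ k t).natDegree ≤ t ∧
      Real.log ((R t ^ k t).map (Int.castRingHom ℂ)).mahlerMeasure ≤ κ * t / 3600 ∧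
      ‖aeval θ (R t ^ k t)‖ ≤ Real.exp (-(κ * t ^ 2 / 64800)))
    (hα : ∀ t, δ₁ ≤ t → α t ∈ ((R t).map (Int.castRingHom ℂ)).roots ∧
      ∀ β ∈ ((R t).map (Int.castRingHom ℂ)).roots, ‖θ - α t‖ ≤ ‖θ - β‖)
    (N : ℕ) : ∃ t, N ≤ t ∧ δ₁ ≤ t ∧ 1 ≤ t ∧ (t : ℝ) / 3600 ≤ (R t ^ k t).natDegree ∧
      ‖θ - α t‖ ≤ Real.exp (-(κ * t ^ 2 / 10 ^ 7)) := by
  by_contra hne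
  push Not at hne
  set n₀ : ℕ := max (max δ₁ 20) N with hn₀
  refine step_four θ hθ κ hκ δ₁ R k α hQ hα n₀ (le_trans (le_max_left _ _) (le_max_left _ _))
    (le_trans (le_max_right _ _) (le_max_left _ _)) fun t ht h => ?_
  have h1 : N ≤ t := le_trans (le_max_right _ _) ht
  have h2 : δ₁ ≤ t := le_trans (le_trans (le_max_left _ _) (le_max_left _ _)) ht
  have h3 : 1 ≤ t := le_trans (by norm_num) (le_trans (le_trans (le_max_right _ _) (le_max_left _ _)) ht)
  exact absurd h.2 (not_le.mpr (hne t h1 h2 h3 h.1))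

/-! ### Théorème 3.2 -/

set_option maxHeartbeats 400000 in
/-- **Théorème 3.2** of Roy–Waldschmidt 1997 (p. 763), with `c₀ = 10⁷`: let `θ ∈ ℂ` be
transcendental and `κ ≥ c₀`.  Then for infinitely many integers `d ≥ 1` there is an algebraic
number `α` of degree `d` and absolute logarithmic height `h(α) ≤ κ` with `|θ - α| ≤ exp(-c₀⁻¹κd²)`.
Rendering: for every `N` there is an irreducible `P ∈ ℤ[X]` of degree `d ≥ N` with
`log M(P) ≤ κ d` (so that any root `α` of `P` has degree `d` and `h(α) = log M(P)/d ≤ κ`) and a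
root `α` of `P` with `|θ - α| ≤ exp(-10⁻⁷ κ d²)`.
[cite: RoyWaldschmidt1997ENS, Théorème 3.2, p. 763; proof §3 (iv), pp. 769–771] -/
theorem thm_3_2 (θ : ℂ) (hθ : Transcendental ℚ θ) (κ : ℝ) (hκ : (10 : ℝ) ^ 7 ≤ κ) (N : ℕ) :
    ∃ P : ℤ[X], Irreducible P ∧ N ≤ P.natDegree ∧
      Real.log (P.map (Int.castRingHom ℂ)).mahlerMeasure ≤ κ * P.natDegree ∧
      ∃ a ∈ (P.map (Int.castRingHom ℂ)).roots,
        ‖θ - a‖ ≤ Real.exp (-(κ * (P.natDegree : ℝ) ^ 2 / 10 ^ 7)) := by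
  classical
  have hκ36 : (3600 : ℝ) ≤ κ := le_trans (by norm_num) hκ
  have hκpos : 0 < κ := by linarith
  -- the sequence of Proposition 3.9 (`b = 1/18`, `δ = t`, `μ = κ t / 3600`)
  obtain ⟨δ₀, hδ₀⟩ := prop_3_9 θ (b := 1 / 18) (by norm_num) (by norm_num)
  set δ₁ : ℕ := max δ₀ 1 with hδ₁
  have hex : ∀ t : ℕ, ∃ Rk : ℤ[X] × ℕ, δ₁ ≤ t → Irreducible Rk.1 ∧ 0 < Rk.2 ∧
      (Rk.1 ^ Rk.2).natDegree ≤ t ∧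
      Real.log ((Rk.1 ^ Rk.2).map (Int.castRingHom ℂ)).mahlerMeasure ≤ κ * t / 3600 ∧
      ‖aeval θ (Rk.1 ^ Rk.2)‖ ≤ Real.exp (-(κ * t ^ 2 / 64800)) := by
    intro t
    by_cases ht : δ₁ ≤ t
    · have hμ : (t : ℝ) ≤ κ * t / 3600 := by
        rw [le_div_iff₀ (by norm_num)]; nlinarith [Nat.cast_nonneg (α := ℝ) t]
      obtain ⟨Q, -, ⟨R, k, hR, hk, rfl⟩, hdeg, hM, hsm⟩ :=
        hδ₀ t (le_trans (le_max_left _ _) ht) (κ * t / 3600) hμ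
      refine ⟨(R, k), fun _ => ⟨hR, hk, hdeg, hM, hsm.trans (le_of_eq ?_)⟩⟩
      congr 1; ring
    · exact ⟨(0, 0), fun h => absurd h ht⟩
  choose Rk hRk using hex
  set R : ℕ → ℤ[X] := fun t => (Rk t).1 with hRdef
  set k : ℕ → ℕ := fun t => (Rk t).2 with hkdef
  have hQ : ∀ t, δ₁ ≤ t → Irreducible (R t) ∧ 0 < k t ∧ (R t ^ k t).natDegree ≤ t ∧
      Real.log ((R t ^ k t).map (Int.castRingHom ℂ)).mahlerMeasure ≤ κ * t / 3600 ∧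
      ‖aeval θ (R t ^ k t)‖ ≤ Real.exp (-(κ * t ^ 2 / 64800)) := fun t ht => hRk t ht
  -- closest roots
  have hexα : ∀ t : ℕ, ∃ a : ℂ, δ₁ ≤ t → a ∈ ((R t).map (Int.castRingHom ℂ)).roots ∧
      ∀ β ∈ ((R t).map (Int.castRingHom ℂ)).roots, ‖θ - a‖ ≤ ‖θ - β‖ := by
    intro t
    by_cases ht : δ₁ ≤ t
    · have hf := seq_facts θ hθ κ hκpos δ₁ R k hQ t ht (le_trans (le_max_right _ _) ht)
      have hne : ((R t).map (Int.castRingHom ℂ)).roots.toFinset.Nonempty := by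
        have hdeg : 0 < ((R t).map (Int.castRingHom ℂ)).degree := by
          rw [degree_map_eq_of_injective (RingHom.injective_int _)]
          exact natDegree_pos_iff_degree_pos.mp hf.2.1
        obtain ⟨z, hz⟩ := Complex.exists_root hdeg
        refine ⟨z, Multiset.mem_toFinset.mpr ((mem_roots ?_).mpr hz)⟩
        exact (Polynomial.map_ne_zero_iff (RingHom.injective_int _)).mpr hf.1
      obtain ⟨a, ha, hmin⟩ := Finset.exists_min_image _ (fun z => ‖θ - z‖) hne
      exact ⟨a, fun _ => ⟨Multiset.mem_toFinset.mp ha, fun β hβ => hmin β (Multiset.mem_toFinset.mpr hβ)⟩⟩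
    · exact ⟨0, fun h => absurd h ht⟩
  choose α hα using hexα
  -- (3.10) infinitely often; Northcott
  by_contra hcon
  push Not at hcon
  -- every good index has `deg R_t < N` and `log M(R_t) ≤ κ N`
  have hgood : ∀ t, δ₁ ≤ t → 1 ≤ t → (t : ℝ) / 3600 ≤ (R t ^ k t).natDegree →
      ‖θ - α t‖ ≤ Real.exp (-(κ * t ^ 2 / 10 ^ 7)) →
      (R t).natDegree < N ∧ Real.log ((R t).map (Int.castRingHom ℂ)).mahlerMeasure ≤ κ * N := by
    intro t ht ht1 hdeg hdist
    obtain ⟨hR, hk, hdegQ, hM, -⟩ := hQ t ht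
    have hf := seq_facts θ hθ κ hκpos δ₁ R k hQ t ht ht1
    have hk0 : (0 : ℝ) < k t := by exact_mod_cast hk
    -- `log M(R_t) ≤ κ deg R_t`
    have hMR : Real.log ((R t).map (Int.castRingHom ℂ)).mahlerMeasure ≤ κ * (R t).natDegree := by
      have h1 : (k t : ℝ) * Real.log ((R t).map (Int.castRingHom ℂ)).mahlerMeasure ≤ κ * t / 3600 := by
        rw [← log_mahlerMeasure_pow]; exact hM
      have h2 : κ * t / 3600 ≤ κ * ((k t : ℝ) * (R t).natDegree) := by
        have : ((R t ^ k t).natDegree : ℝ) = k t * (R t).natDegree := by rw [natDegree_pow]; push_cast; ring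
        rw [← this]
        have := mul_le_mul_of_nonneg_left hdeg hκpos.le
        linarith
      have h3 : (k t : ℝ) * Real.log ((R t).map (Int.castRingHom ℂ)).mahlerMeasure ≤
          k t * (κ * (R t).natDegree) := by nlinarith
      exact le_of_mul_le_mul_left h3 hk0
    have hlt : (R t).natDegree < N := by
      by_contra hN
      push Not at hN
      have hroot : α t ∈ ((R t).map (Int.castRingHom ℂ)).roots := (hα t ht).1
      have := hcon (R t) hR hN hMR (α t) hroot
      refine absurd (hdist.trans (Real.exp_le_exp.mpr ?_)) (not_le.mpr this)
      have hdt : ((R t).natDegree : ℝ) ≤ t := by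
        have h1 : (R t).natDegree ≤ (R t ^ k t).natDegree := by
          rw [natDegree_pow]; exact Nat.le_mul_of_pos_left _ hk
        exact_mod_cast h1.trans hdegQ
      have : ((R t).natDegree : ℝ) ^ 2 ≤ (t : ℝ) ^ 2 := by
        nlinarith [Nat.cast_nonneg (α := ℝ) (R t).natDegree]
      have := div_le_div_of_nonneg_right (mul_le_mul_of_nonneg_left this hκpos.le) (by norm_num : (0:ℝ) ≤ 10 ^ 7)
      linarith
    refine ⟨hlt, hMR.trans ?_⟩
    exact mul_le_mul_of_nonneg_left (by exact_mod_cast hlt.le) hκpos.le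
  -- the finite set of candidate polynomials and of their roots
  set B : NNReal := ⟨Real.exp (κ * N), (Real.exp_pos _).le⟩ with hB
  have hfin := Polynomial.finite_mahlerMeasure_le N B
  set Z : Finset ℂ := hfin.toFinset.biUnion fun p => (p.map (Int.castRingHom ℂ)).roots.toFinset with hZ
  have hαZ : ∀ t, δ₁ ≤ t → 1 ≤ t → (t : ℝ) / 3600 ≤ (R t ^ k t).natDegree →
      ‖θ - α t‖ ≤ Real.exp (-(κ * t ^ 2 / 10 ^ 7)) → α t ∈ Z := by
    intro t ht ht1 hdeg hdist
    obtain ⟨hlt, hM⟩ := hgood t ht ht1 hdeg hdist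
    rw [hZ, Finset.mem_biUnion]
    refine ⟨R t, ?_, Multiset.mem_toFinset.mpr (hα t ht).1⟩
    rw [Set.Finite.mem_toFinset]
    refine ⟨hlt.le, ?_⟩
    change ((R t).map (Int.castRingHom ℂ)).mahlerMeasure ≤ Real.exp (κ * N)
    have hpos : 0 < ((R t).map (Int.castRingHom ℂ)).mahlerMeasure :=
      one_pos.trans_le (one_le_mahlerMeasure_of_ne_zero (hQ t ht).1.ne_zero)
    rw [← Real.exp_log hpos]
    exact Real.exp_le_exp.mpr hM
  -- a first good index makes `Z` nonempty
  obtain ⟨t₀, -, ht₀δ, ht₀1, ht₀deg, ht₀dist⟩ := infinitely_often θ hθ κ hκ36 δ₁ R k α hQ hα 0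
  have hZne : Z.Nonempty := ⟨α t₀, hαZ t₀ ht₀δ ht₀1 ht₀deg ht₀dist⟩
  obtain ⟨z₀, hz₀, hz₀min⟩ := Finset.exists_min_image Z (fun z => ‖θ - z‖) hZne
  -- `θ ∉ Z`
  have hε : 0 < ‖θ - z₀‖ := by
    rw [hZ, Finset.mem_biUnion] at hz₀
    obtain ⟨p, -, hp⟩ := hz₀
    have hp' := Multiset.mem_toFinset.mp hp
    have hp0 : p.map (Int.castRingHom ℂ) ≠ 0 := (mem_roots'.mp hp').1
    have hpz : p ≠ 0 := fun h => hp0 (by rw [h, Polynomial.map_zero])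
    refine norm_pos_iff.mpr (sub_ne_zero.mpr fun h => ?_)
    have h0 : aeval θ p = 0 := by
      rw [h, aeval_def, eval₂_eq_eval_map, algebraMap_int_eq]
      exact (mem_roots'.mp hp').2
    have := norm_aeval_pos_of_transcendental hθ hpz
    rw [h0, norm_zero] at this
    exact lt_irrefl _ this
  -- a good index beyond `T` with `exp(-κ T / 10⁷) < ε`
  set T : ℕ := ⌈-(10 ^ 7 * Real.log ‖θ - z₀‖) / κ⌉₊ + 1 with hT
  obtain ⟨t, hTt, htδ, ht1, htdeg, htdist⟩ := infinitely_often θ hθ κ hκ36 δ₁ R k α hQ hα T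
  have hmem := hαZ t htδ ht1 htdeg htdist
  have hmin := hz₀min (α t) hmem
  have ht' : -(10 ^ 7 * Real.log ‖θ - z₀‖) / κ < t := by
    have h1 := Nat.le_ceil (-(10 ^ 7 * Real.log ‖θ - z₀‖) / κ)
    have h2 : (⌈-(10 ^ 7 * Real.log ‖θ - z₀‖) / κ⌉₊ : ℝ) + 1 ≤ t := by
      rw [hT] at hTt
      exact_mod_cast hTt
    linarith
  have hlt : Real.exp (-(κ * t ^ 2 / 10 ^ 7)) < ‖θ - z₀‖ := by
    rw [← Real.exp_log hε]
    refine Real.exp_lt_exp.mpr ?_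
    have ht1' : (1 : ℝ) ≤ t := by exact_mod_cast ht1
    have h1 : (t : ℝ) ≤ (t : ℝ) ^ 2 := by nlinarith
    have h2 : κ * t / 10 ^ 7 ≤ κ * t ^ 2 / 10 ^ 7 :=
      div_le_div_of_nonneg_right (mul_le_mul_of_nonneg_left h1 hκpos.le) (by norm_num)
    have h3 : -(10 ^ 7 * Real.log ‖θ - z₀‖) < κ * t := by
      rw [div_lt_iff₀ hκpos] at ht'; linarith
    linarith
  exact absurd (hmin.trans htdist) (not_le.mpr hlt)

end RoyWaldschmidt1997

end Literature.NumberTheory.Transcendental
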